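import Mathlib

/-!
# Algebraic tail lemma for `RationalDescent` — child 3 of the lens-1-g38 split of `RationalPeriodQuarter.SemiAnalyticRigidity`

(decomp-langlands node `SemiAnalyticRigiditySplit`, split of stmt-Langlands-2806.)  The one algebraic input of
the rational descent: if a complex rational function `P/Q` has translation coboundary
`P(t+1)/Q(t+1) - P(t)/Q(t)` equal, at infinitely many real points, to a fraction `P'/D'` with a RATIONAL
denominator `D' ∈ ℚ[X]`, then `P/Q` itself is a fraction with a rational denominator:
`P/Q = P₂ / D` with `D ∈ ℚ[X]`, `D ≠ 0`, wherever `D` and `Q` do not vanish.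

Mechanism: after removing common roots of `P, Q`, a pole `β` of `P/Q` with `β + 1` not a pole is a root of
`D'` (evaluate the cross-multiplied polynomial identity at `β`), hence algebraic over `ℚ`; walking right along
`β, β+1, β+2, …` every pole is algebraic; a complex polynomial with algebraic roots divides the image of a
rational polynomial (product of minimal polynomials).  Mathlib only.
-/

set_option linter.dupNamespace false

namespace Summit.Langlands.Langlands.Theorems

open Polynomial

/-- `aeval z D` (`D : ℚ[X]`, `z : ℂ`) is evaluation of the mapped polynomial. -/
theorem ratDescent_aeval_eq_eval_map (D : ℚ[X]) (z : ℂ) :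
    aeval z D = (D.map (algebraMap ℚ ℂ)).eval z := by
  rw [Polynomial.eval_map, Polynomial.aeval_def]

/-- Removing common roots: `P/Q = P₁/Q₁` with `P₁, Q₁` without common root (cross-multiplied form). -/
theorem ratDescent_remove_common_roots :
    ∀ n : ℕ, ∀ P Q : ℂ[X], Q.natDegree = n → Q ≠ 0 →
      ∃ P₁ Q₁ : ℂ[X], Q₁ ≠ 0 ∧ (∀ β : ℂ, ¬ (P₁.IsRoot β ∧ Q₁.IsRoot β)) ∧ P * Q₁ = P₁ * Q := by
  intro n
  induction n using Nat.strong_induction_on with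
  | _ n ih =>
    intro P Q hdeg hQ
    by_cases hc : ∃ β : ℂ, P.IsRoot β ∧ Q.IsRoot β
    · obtain ⟨β, hPβ, hQβ⟩ := hc
      obtain ⟨P', hP'⟩ := Polynomial.dvd_iff_isRoot.2 hPβ
      obtain ⟨Q', hQ'⟩ := Polynomial.dvd_iff_isRoot.2 hQβ
      have hQ'ne : Q' ≠ 0 := by rintro rfl; exact hQ (by rw [hQ', mul_zero])
      have hQ'deg : Q'.natDegree < n := by
        have := congrArg Polynomial.natDegree hQ'
        rw [Polynomial.natDegree_mul (Polynomial.X_sub_C_ne_zero β) hQ'ne,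
          Polynomial.natDegree_X_sub_C, hdeg] at this
        omega
      obtain ⟨P₁, Q₁, hQ₁, hno, hcross⟩ := ih _ hQ'deg P' Q' rfl hQ'ne
      refine ⟨P₁, Q₁, hQ₁, hno, ?_⟩
      rw [hP', hQ', mul_assoc, hcross, ← mul_assoc, ← mul_assoc, mul_comm (X - C β) P₁]
    · push Not at hc
      exact ⟨P, Q, hQ, fun β h => hc β h.1 h.2, rfl⟩

/-- A nonzero complex polynomial all of whose roots are algebraic over `ℚ` divides the image of a nonzero
rational polynomial. -/
theorem ratDescent_dvd_map_of_roots_algebraic :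
    ∀ n : ℕ, ∀ Q : ℂ[X], Q.natDegree = n → Q ≠ 0 → (∀ β : ℂ, Q.IsRoot β → IsAlgebraic ℚ β) →
      ∃ D : ℚ[X], D ≠ 0 ∧ Q ∣ D.map (algebraMap ℚ ℂ) := by
  intro n
  induction n with
  | zero =>
    intro Q hdeg hQ _
    refine ⟨1, one_ne_zero, ?_⟩
    have hunit : IsUnit Q := by
      rw [Polynomial.eq_C_of_natDegree_eq_zero hdeg]
      refine Polynomial.isUnit_C.2 (IsUnit.mk0 _ fun h => hQ ?_)
      rw [Polynomial.eq_C_of_natDegree_eq_zero hdeg, h, map_zero]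
    exact hunit.dvd
  | succ n ih =>
    intro Q hdeg hQ halg
    have hdeg' : 0 < Q.degree := by
      rw [Polynomial.degree_eq_natDegree hQ, hdeg]; exact_mod_cast Nat.succ_pos n
    obtain ⟨β, hβ⟩ := Complex.exists_root hdeg'
    obtain ⟨Q₂, hQ₂⟩ := Polynomial.dvd_iff_isRoot.2 hβ
    have hQ₂ne : Q₂ ≠ 0 := by rintro rfl; exact hQ (by rw [hQ₂, mul_zero])
    have hQ₂deg : Q₂.natDegree = n := by
      have := congrArg Polynomial.natDegree hQ₂
      rw [Polynomial.natDegree_mul (Polynomial.X_sub_C_ne_zero β) hQ₂ne,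
        Polynomial.natDegree_X_sub_C, hdeg] at this
      omega
    have halg₂ : ∀ b : ℂ, Q₂.IsRoot b → IsAlgebraic ℚ b := fun b hb =>
      halg b (by rw [hQ₂, Polynomial.root_mul]; exact Or.inr hb)
    obtain ⟨D₂, hD₂, hdvd₂⟩ := ih Q₂ hQ₂deg hQ₂ne halg₂
    have hint : IsIntegral ℚ β := (halg β hβ).isIntegral
    have hXm : (X - C β) ∣ (minpoly ℚ β).map (algebraMap ℚ ℂ) := by
      rw [Polynomial.dvd_iff_isRoot, Polynomial.IsRoot.def, Polynomial.eval_map,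
        ← Polynomial.aeval_def]
      exact minpoly.aeval ℚ β
    refine ⟨minpoly ℚ β * D₂, mul_ne_zero (minpoly.ne_zero hint) hD₂, ?_⟩
    rw [Polynomial.map_mul, hQ₂]
    exact mul_dvd_mul hXm hdvd₂

/-- Pole propagation: from the cross-multiplied coboundary identity, every root of `Q₁` (no common root with
`P₁`) is algebraic over `ℚ`. -/
theorem ratDescent_roots_algebraic (P₁ Q₁ P' : ℂ[X]) (D' : ℚ[X]) (hQ₁ : Q₁ ≠ 0) (hD' : D' ≠ 0)
    (hno : ∀ β : ℂ, ¬ (P₁.IsRoot β ∧ Q₁.IsRoot β))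
    (hΨ : (P₁.comp (X + 1) * Q₁ - P₁ * Q₁.comp (X + 1)) * D'.map (algebraMap ℚ ℂ) =
      P' * (Q₁.comp (X + 1) * Q₁)) :
    ∀ β : ℂ, Q₁.IsRoot β → IsAlgebraic ℚ β := by
  classical
  -- end of a chain: a root β with β + 1 not a root is a root of D'
  have hend : ∀ β : ℂ, Q₁.IsRoot β → ¬ Q₁.IsRoot (β + 1) → IsAlgebraic ℚ β := by
    intro β hβ hβ1
    refine ⟨D', hD', ?_⟩
    have hev := congrArg (Polynomial.eval β) hΨ
    have hQβ : Q₁.eval β = 0 := hβ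
    simp only [Polynomial.eval_mul, Polynomial.eval_sub, Polynomial.eval_comp, Polynomial.eval_add,
      Polynomial.eval_X, Polynomial.eval_one, hQβ, mul_zero, zero_sub] at hev
    -- hev : -(P₁.eval β * Q₁.eval (β+1)) * (D'.map _).eval β = 0   (up to normal form)
    have hP : P₁.eval β ≠ 0 := fun h => hno β ⟨h, hβ⟩
    have hQ : Q₁.eval (β + 1) ≠ 0 := hβ1
    rw [ratDescent_aeval_eq_eval_map]
    rcases mul_eq_zero.1 hev with h | h
    · exact absurd (neg_eq_zero.1 h) (mul_ne_zero hP hQ)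
    · exact h
  -- walk right: strong induction on the number of roots strictly to the right of β
  have key : ∀ k : ℕ, ∀ β : ℂ, Q₁.IsRoot β →
      (Q₁.roots.toFinset.filter (fun z => β.re < z.re)).card = k → IsAlgebraic ℚ β := by
    intro k
    induction k using Nat.strong_induction_on with
    | _ k ih =>
      intro β hβ hk
      by_cases h1 : Q₁.IsRoot (β + 1)
      · have hsub : Q₁.roots.toFinset.filter (fun z => (β + 1).re < z.re) ⊆
            Q₁.roots.toFinset.filter (fun z => β.re < z.re) := by
          intro z hz
          simp only [Finset.mem_filter, Complex.add_re, Complex.one_re] at hz ⊢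
          exact ⟨hz.1, by linarith [hz.2]⟩
        have hmem : β + 1 ∈ Q₁.roots.toFinset.filter (fun z => β.re < z.re) := by
          simp only [Finset.mem_filter, Multiset.mem_toFinset, Polynomial.mem_roots hQ₁,
            Complex.add_re, Complex.one_re]
          exact ⟨h1, by linarith⟩
        have hnmem : β + 1 ∉ Q₁.roots.toFinset.filter (fun z => (β + 1).re < z.re) := by
          simp only [Finset.mem_filter, not_and, not_lt]
          intro _; exact le_rfl
        have hlt : (Q₁.roots.toFinset.filter (fun z => (β + 1).re < z.re)).card < k := by
          rw [← hk]
          exact Finset.card_lt_card (Finset.ssubset_iff_of_subset hsub |>.2 ⟨β + 1, hmem, hnmem⟩)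
        have halg1 : IsAlgebraic ℚ (β + 1) := ih _ hlt (β + 1) h1 rfl
        have : IsAlgebraic ℚ (β + 1 - 1) := halg1.sub isAlgebraic_one
        simpa using this
      · exact hend β hβ h1
  intro β hβ
  exact key _ β hβ rfl

/-- THE ALGEBRAIC TAIL LEMMA.  If `P(t+1)/Q(t+1) - P(t)/Q(t) = P'(t)/D'(t)` with `D' ∈ ℚ[X]` at infinitely many
real points (where the denominators do not vanish), then `P/Q = P₂/D` for some `D ∈ ℚ[X]`, `D ≠ 0`, at every
complex point where `D` and `Q` do not vanish. -/
theorem ratDescent_rat_denominator (P Q P' : ℂ[X]) (D' : ℚ[X]) (hQ : Q ≠ 0) (hD' : D' ≠ 0)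
    (S : Set ℝ) (hS : S.Infinite)
    (h : ∀ t ∈ S, Q.eval (t : ℂ) ≠ 0 ∧ Q.eval ((t : ℂ) + 1) ≠ 0 ∧ aeval (t : ℂ) D' ≠ 0 ∧
      P.eval ((t : ℂ) + 1) / Q.eval ((t : ℂ) + 1) - P.eval (t : ℂ) / Q.eval (t : ℂ) =
        P'.eval (t : ℂ) / aeval (t : ℂ) D') :
    ∃ (P₂ : ℂ[X]) (D : ℚ[X]), D ≠ 0 ∧ ∀ z : ℂ, aeval z D ≠ 0 → Q.eval z ≠ 0 →
      P.eval z / Q.eval z = P₂.eval z / aeval z D := by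
  classical
  obtain ⟨P₁, Q₁, hQ₁, hno, hcross⟩ := ratDescent_remove_common_roots _ P Q rfl hQ
  -- where Q ≠ 0, also Q₁ ≠ 0 and P/Q = P₁/Q₁
  have hQQ₁ : ∀ z : ℂ, Q.eval z ≠ 0 → Q₁.eval z ≠ 0 := by
    intro z hz h0
    have := congrArg (Polynomial.eval z) hcross
    simp only [Polynomial.eval_mul, h0, mul_zero] at this
    rcases mul_eq_zero.1 this.symm with h | h
    · exact hno z ⟨h, h0⟩
    · exact hz h
  have hPQ : ∀ z : ℂ, Q.eval z ≠ 0 → P.eval z / Q.eval z = P₁.eval z / Q₁.eval z := by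
    intro z hz
    rw [div_eq_div_iff hz (hQQ₁ z hz)]
    have := congrArg (Polynomial.eval z) hcross
    simpa only [Polynomial.eval_mul] using this
  -- the cross-multiplied identity holds at the (infinitely many) points of S, hence as polynomials
  have hΨ : (P₁.comp (X + 1) * Q₁ - P₁ * Q₁.comp (X + 1)) * D'.map (algebraMap ℚ ℂ) =
      P' * (Q₁.comp (X + 1) * Q₁) := by
    apply Polynomial.eq_of_infinite_eval_eq
    have hsub : ((fun t : ℝ => (t : ℂ)) '' S) ⊆ {x : ℂ | eval x ((P₁.comp (X + 1) * Q₁ -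
        P₁ * Q₁.comp (X + 1)) * D'.map (algebraMap ℚ ℂ)) = eval x (P' * (Q₁.comp (X + 1) * Q₁))} := by
      rintro _ ⟨t, ht, rfl⟩
      obtain ⟨hQt, hQt1, hDt, hid⟩ := h t ht
      have hQ₁t := hQQ₁ _ hQt
      have hQ₁t1 := hQQ₁ _ hQt1
      rw [hPQ _ hQt, hPQ _ hQt1, div_sub_div _ _ hQ₁t1 hQ₁t,
        div_eq_div_iff (mul_ne_zero hQ₁t1 hQ₁t) hDt, ratDescent_aeval_eq_eval_map] at hid
      simp only [Set.mem_setOf_eq, Polynomial.eval_mul, Polynomial.eval_sub, Polynomial.eval_comp,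
        Polynomial.eval_add, Polynomial.eval_X, Polynomial.eval_one]
      linear_combination hid
    exact Set.Infinite.mono hsub (hS.image Complex.ofReal_injective.injOn)
  -- all roots of Q₁ are algebraic, so Q₁ divides the image of a rational polynomial D
  have halg := ratDescent_roots_algebraic P₁ Q₁ P' D' hQ₁ hD' hno hΨ
  obtain ⟨D, hD, W, hW⟩ := ratDescent_dvd_map_of_roots_algebraic _ Q₁ rfl hQ₁ halg
  refine ⟨P₁ * W, D, hD, fun z hDz hQz => ?_⟩
  rw [ratDescent_aeval_eq_eval_map] at hDz ⊢
  rw [hW, Polynomial.eval_mul] at hDz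
  rw [hPQ z hQz, hW, Polynomial.eval_mul, Polynomial.eval_mul,
    mul_div_mul_right _ _ (right_ne_zero_of_mul hDz)]

end Summit.Langlands.Langlands.Theorems
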